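import Literature.Analysis.FluidPDE.TorusNSWavenumberEvolution
import HarnessLib

/-!
# Agmon's inequality at every rung on `T³` and Doering–Gibbon's (6.4.7):
# `|Dʳu(x)|² ≤ (2/π²) H_{r+1}^{1/2} H_{r+2}^{1/2} ≤ (2/π²) F_r κ³_{N,r}`

search for candidate a priori estimates; no regularity claim (cell `pub-nsfunc`, literature seat:
this file types a PUBLISHED inequality, nothing new).

Analysis/FluidPDE proof file (theorems only; no definitions, no named facts), sequel of
`TorusNSWavenumberTimeAverages` / `TorusNSWavenumberEvolution`. Doering–Gibbon 1995 §6.4 observe that the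
dynamical wavenumbers `κ_{N,r} = (F_N/F_r)^{1/(2(N−r))}` "mediate between the `L^∞` and `L²` norms":
from the calculus inequality (6.4.6) `‖Dʳuᵢ‖_∞ ≤ c‖Dᴺuᵢ‖₂^a‖Dʳuᵢ‖₂^{1−a}`, `a = d/(2(N−r))`, `N > r + d/2`,
"dividing through (6.4.6) by `F_r^{a/2}`, we find that `‖Dʳuᵢ‖_∞ ≤ c κ_{N,r}^{d/2} ‖Dʳuᵢ‖₂` (6.4.7)".
This file proves the case `d = 3` at EVERY `r` and every admissible `N ≥ r + 2` on the unit torus, with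
the tree's explicit Agmon constant, for smooth zero-mean `v : T³ → ℝ³` (`E_n = Torus.wordEnergy n`
`= H_n`, `F_n = Torus.ladderF ν n g v = E_n(v) + ν⁻²E_n(g)`, `|Dʳv(x)|² = ∑_{|α|=r} ‖∂^α v(x)‖²` over
all ordered words):

* `Torus.sum_wordEnergy_partialDeriv_eq` — `∑ₐ E_n(∂ₐ f) = E_{n+1}(f)` (bookkeeping);
* `Torus.sum_norm_sq_wordDeriv_le_agmon_wordEnergy` — **Agmon at every rung**:
  `∑_{|α|=r} ‖∂^α v(x)‖² ≤ (2/π²) E_{r+1}(v)^{1/2} E_{r+2}(v)^{1/2}` (zero-mean `v`; by induction on `r`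
  from the tree's `‖v‖²_∞ ≤ (2/π²)‖∇v‖₂‖Δv‖₂`, `Torus.norm_sq_le_two_div_pi_sq_mul_sqrt`, applied to the
  `∂ᵢv` and Cauchy–Schwarz over `i`), and `Torus.sum_norm_sq_wordDeriv_succ_le_agmon_wordEnergy` (the
  same at rung `r + 1` with no mean condition);
* `Torus.sum_norm_sq_wordDeriv_le_ladderF_mul_wavenumber_cube` — **(6.4.7), `d = 3`**: for `N ≥ r + 2`
  and `F_r > 0`, `∑_{|α|=r} ‖∂^α v(x)‖² ≤ (2/π²) F_r κ³_{N,r}` (Lemma 6.3 `F_{r+1}² ≤ F_rF_{r+2}` gives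
  `E_{r+1}^{1/2}E_{r+2}^{1/2} ≤ F_r^{1/4}F_{r+2}^{3/4} = F_r κ³_{r+2,r}`, then the ordering
  `κ_{r+2,r} ≤ κ_{N,r}`, `Torus.ladderF_wavenumber_le_succ_left`) — i.e. `‖Dʳv‖_∞ ≤ c κ_{N,r}^{3/2} F_r^{1/2}`,
  the square of (6.4.7) (`d/2 = 3/2`), obtained at `N = r + 2` (`a = 3/4`) and propagated to every
  `N ≥ r + 2` by the ordering.
* §4: the same three statements in the tree's pointwise notation `wordGradSq r v x = ∑_{|α|=r}‖∂^α v(x)‖²`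
  (`wordGradSq_le_agmon_wordEnergy`, `wordGradSq_succ_le_agmon_wordEnergy`,
  `wordGradSq_le_ladderF_mul_wavenumber_cube`).

Faithfulness / deviations: unit torus, `d = 3` only (the book: `d = 2, 3`, general `N > r + d/2` by
Gagliardo–Nirenberg; here `N ≥ r + 2` via Agmon + Lemma 6.2/6.3 + ordering, which is all the admissible
`N` in `d = 3`), the whole gradient `Dʳv` (Frobenius, all ordered words) instead of the components `Dʳuᵢ`,
zero-mean `v` (automatic for the velocity slices of the cell), constant `2/π²` explicit where the book has
`c`. The cases `r = 0, 1` are (7.3.29)/(7.3.22) of `TorusNSWavenumberTimeAverages`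
(`norm_sq_le_ladderF_mul_wavenumber`, `sum_norm_sq_partialDeriv_le_ladderF_mul_wavenumber_cube`).
-- TODO(general form): `d = 2`, box length `L`.

## Mathlib / tree search

Tree (reused): `TorusAgmonExplicit` (`norm_sq_le_two_div_pi_sq_mul_sqrt`), `TorusWordEnergy`
(`wordEnergy_succ'`), `TorusWordSpaceTime` (`wordDeriv_partialDeriv_comm`), `TorusNSLadderInequality`
(`ladderF`, `ladderF_pow_le_pow_mul_pow`), `TorusNSWavenumberTimeAverages`
(`wordEnergy_two_eq_integral_laplacian_sq`, `wordEnergy_le_ladderF`), `TorusNSWavenumberEvolution`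
(`ladderF_nonneg`, `ladderF_wavenumber_le_succ_left`), `TorusConvectionLaplacianNormSq`
(`hasZeroMean_partialDeriv`). Searched `agmon.*wordEnergy|wordDeriv.*sup|κ`: only the rungs `r = 0, 1`.
Mathlib: `Real.sum_sqrt_mul_sqrt_le`, `pow_le_pow_iff_left₀`, `Real.rpow_inv_natCast_pow`.

## References

* C. R. Doering, J. D. Gibbon, *Applied Analysis of the Navier–Stokes Equations*, CUP 1995, §6.4
  (6.4.6)–(6.4.7); Appendix A (A.0.18) (Agmon); §7.3 (7.3.4), (7.3.22), (7.3.29) (held: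
  `book:doering1995-applied-analysis-navier-stokes-equations`, chunks p0106, p0119–p0122). [DoeringGibbon1995]
* S. Agmon, *Lectures on Elliptic Boundary Value Problems*, Van Nostrand 1965 (the inequality (A.0.18)).
-/

noncomputable section

open MeasureTheory Set Function Real
open scoped ContDiff InnerProductSpace RealInnerProductSpace

namespace Literature.Analysis.FluidPDE

namespace Torus

open FunctionSpaces FunctionSpaces.Torus

variable {d : Type*} [Fintype d] [DecidableEq d]

/-! ## §1 Bookkeeping -/

/-- **Inner letters**: `∑ₐ E_n(∂ₐ f) = E_{n+1}(f)` for smooth `f` (partial derivatives commute).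
[cite: DoeringGibbon1995, §6.1 (6.1.2)] (bookkeeping) -/
theorem sum_wordEnergy_partialDeriv_eq {F' : Type*} [NormedAddCommGroup F'] [InnerProductSpace ℝ F']
    {f : UnitAddTorus d → F'} (hf : IsSmooth f) (n : ℕ) :
    ∑ a, wordEnergy n (Torus.partialDeriv a f) = wordEnergy (n + 1) f := by
  rw [wordEnergy_succ']
  unfold wordEnergy
  rw [Finset.sum_comm]
  refine Finset.sum_congr rfl fun u _ => Finset.sum_congr rfl fun a _ => ?_
  rw [wordDeriv_partialDeriv_comm hf a]

/-- `E_1(v) = ‖∇v‖₂²` (private: the same identity lives in a `Summits/` file that `Literature/` cannot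
import, and privately in the sibling files). [cite: DoeringGibbon1995, §6.1 (6.1.2)] (bookkeeping) -/
private theorem wordEnergy_one_eq_gradNormSq'' {v : UnitAddTorus d → EuclideanSpace ℝ d} (hv : IsSmooth v) :
    wordEnergy 1 v = gradNormSq v := by
  rw [wordEnergy_succ', Torus.gradNormSq]
  have hint : ∀ i, Integrable (fun x => ‖Torus.partialDeriv i v x‖ ^ 2) volume := fun i =>
    ((hv.partialDeriv i).continuous.norm.pow 2).integrable_unitAddTorus
  rw [integral_finsetSum _ fun i _ => hint i]
  simp

/-! ## §2 Agmon at every rung -/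

/-- **Agmon's inequality at every rung, `d = 3`**: for a smooth zero-mean `v : T³ → ℝ³`, every `r` and
every `x`, `∑_{|α|=r} ‖∂^α v(x)‖² ≤ (2/π²) E_{r+1}(v)^{1/2} E_{r+2}(v)^{1/2}` — the case `N = r + 2` of
(6.4.6) (`a = 3/4` after `E_{r+1}² ≤ E_rE_{r+2}`), with the tree's explicit constant.
[cite: DoeringGibbon1995, §6.4 (6.4.6); Appendix A (A.0.18); §7.3.1 (7.3.4)] -/
theorem sum_norm_sq_wordDeriv_le_agmon_wordEnergy (hd : Fintype.card d = 3)
    {v : UnitAddTorus d → EuclideanSpace ℝ d} (hv : IsSmooth v) (hmean : HasZeroMean v) (r : ℕ)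
    (x : UnitAddTorus d) :
    ∑ α : Fin r → d, ‖wordDeriv (List.ofFn α) v x‖ ^ 2 ≤
      2 / π ^ 2 * Real.sqrt (wordEnergy (r + 1) v) * Real.sqrt (wordEnergy (r + 2) v) := by
  have hπ : 0 < π := Real.pi_pos
  induction r generalizing v with
  | zero =>
    have h1 := norm_sq_le_two_div_pi_sq_mul_sqrt hd hv hmean x
    rw [← wordEnergy_one_eq_gradNormSq'' hv, ← wordEnergy_two_eq_integral_laplacian_sq hv] at h1
    simpa using h1
  | succ r ih =>
    -- split off the outer letter and commute it inside: `∂^{i::β} v = ∂^β (∂ᵢ v)`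
    rw [← (Fin.consEquiv fun _ : Fin (r + 1) => d).sum_comp, Fintype.sum_prod_type]
    have e : ∀ i (β : Fin r → d), wordDeriv (List.ofFn ((Fin.consEquiv fun _ : Fin (r + 1) => d) (i, β))) v =
        wordDeriv (List.ofFn β) (Torus.partialDeriv i v) := by
      intro i β
      have : List.ofFn ((Fin.consEquiv fun _ : Fin (r + 1) => d) (i, β)) = i :: List.ofFn β := by
        simp [Fin.consEquiv]
      rw [this, wordDeriv_cons, wordDeriv_partialDeriv_comm hv i]
    simp_rw [e]
    -- Agmon at rung `r` for each `∂ᵢ v`, then Cauchy–Schwarz over `i`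
    have hstep : ∀ i, ∑ β : Fin r → d, ‖wordDeriv (List.ofFn β) (Torus.partialDeriv i v) x‖ ^ 2 ≤
        2 / π ^ 2 * Real.sqrt (wordEnergy (r + 1) (Torus.partialDeriv i v)) *
          Real.sqrt (wordEnergy (r + 2) (Torus.partialDeriv i v)) :=
      fun i => ih (hv.partialDeriv i) (hasZeroMean_partialDeriv hv i)
    have hCS := Real.sum_sqrt_mul_sqrt_le (Finset.univ : Finset d)
      (fun i => wordEnergy_nonneg (r + 1) (Torus.partialDeriv i v))
      (fun i => wordEnergy_nonneg (r + 2) (Torus.partialDeriv i v))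
    rw [sum_wordEnergy_partialDeriv_eq hv (r + 1), sum_wordEnergy_partialDeriv_eq hv (r + 2)] at hCS
    calc ∑ i, ∑ β : Fin r → d, ‖wordDeriv (List.ofFn β) (Torus.partialDeriv i v) x‖ ^ 2
        ≤ ∑ i, 2 / π ^ 2 * Real.sqrt (wordEnergy (r + 1) (Torus.partialDeriv i v)) *
            Real.sqrt (wordEnergy (r + 2) (Torus.partialDeriv i v)) := Finset.sum_le_sum fun i _ => hstep i
      _ = 2 / π ^ 2 * ∑ i, Real.sqrt (wordEnergy (r + 1) (Torus.partialDeriv i v)) *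
            Real.sqrt (wordEnergy (r + 2) (Torus.partialDeriv i v)) := by
          rw [Finset.mul_sum]; refine Finset.sum_congr rfl fun i _ => ?_; ring
      _ ≤ 2 / π ^ 2 * (Real.sqrt (wordEnergy (r + 1 + 1) v) * Real.sqrt (wordEnergy (r + 2 + 1) v)) :=
          mul_le_mul_of_nonneg_left hCS (by positivity)
      _ = _ := by ring_nf

/-- **Agmon at every rung `r + 1`, no mean condition**: for a smooth `v : T³ → ℝ³`, every `r` and `x`,
`∑_{|α|=r+1} ‖∂^α v(x)‖² ≤ (2/π²) E_{r+2}(v)^{1/2} E_{r+3}(v)^{1/2}` (the `∂ᵢv` have zero mean).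
[cite: DoeringGibbon1995, §6.4 (6.4.6); Appendix A (A.0.18)] -/
theorem sum_norm_sq_wordDeriv_succ_le_agmon_wordEnergy (hd : Fintype.card d = 3)
    {v : UnitAddTorus d → EuclideanSpace ℝ d} (hv : IsSmooth v) (r : ℕ) (x : UnitAddTorus d) :
    ∑ α : Fin (r + 1) → d, ‖wordDeriv (List.ofFn α) v x‖ ^ 2 ≤
      2 / π ^ 2 * Real.sqrt (wordEnergy (r + 2) v) * Real.sqrt (wordEnergy (r + 3) v) := by
  have hπ : 0 < π := Real.pi_pos
  rw [← (Fin.consEquiv fun _ : Fin (r + 1) => d).sum_comp, Fintype.sum_prod_type]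
  have e : ∀ i (β : Fin r → d), wordDeriv (List.ofFn ((Fin.consEquiv fun _ : Fin (r + 1) => d) (i, β))) v =
      wordDeriv (List.ofFn β) (Torus.partialDeriv i v) := by
    intro i β
    have : List.ofFn ((Fin.consEquiv fun _ : Fin (r + 1) => d) (i, β)) = i :: List.ofFn β := by
      simp [Fin.consEquiv]
    rw [this, wordDeriv_cons, wordDeriv_partialDeriv_comm hv i]
  simp_rw [e]
  have hstep : ∀ i, ∑ β : Fin r → d, ‖wordDeriv (List.ofFn β) (Torus.partialDeriv i v) x‖ ^ 2 ≤
      2 / π ^ 2 * Real.sqrt (wordEnergy (r + 1) (Torus.partialDeriv i v)) *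
        Real.sqrt (wordEnergy (r + 2) (Torus.partialDeriv i v)) :=
    fun i => sum_norm_sq_wordDeriv_le_agmon_wordEnergy hd (hv.partialDeriv i) (hasZeroMean_partialDeriv hv i) r x
  have hCS := Real.sum_sqrt_mul_sqrt_le (Finset.univ : Finset d)
    (fun i => wordEnergy_nonneg (r + 1) (Torus.partialDeriv i v))
    (fun i => wordEnergy_nonneg (r + 2) (Torus.partialDeriv i v))
  rw [sum_wordEnergy_partialDeriv_eq hv (r + 1), sum_wordEnergy_partialDeriv_eq hv (r + 2)] at hCS
  calc ∑ i, ∑ β : Fin r → d, ‖wordDeriv (List.ofFn β) (Torus.partialDeriv i v) x‖ ^ 2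
      ≤ ∑ i, 2 / π ^ 2 * Real.sqrt (wordEnergy (r + 1) (Torus.partialDeriv i v)) *
          Real.sqrt (wordEnergy (r + 2) (Torus.partialDeriv i v)) := Finset.sum_le_sum fun i _ => hstep i
    _ = 2 / π ^ 2 * ∑ i, Real.sqrt (wordEnergy (r + 1) (Torus.partialDeriv i v)) *
          Real.sqrt (wordEnergy (r + 2) (Torus.partialDeriv i v)) := by
        rw [Finset.mul_sum]; refine Finset.sum_congr rfl fun i _ => ?_; ring
    _ ≤ 2 / π ^ 2 * (Real.sqrt (wordEnergy (r + 1 + 1) v) * Real.sqrt (wordEnergy (r + 2 + 1) v)) :=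
        mul_le_mul_of_nonneg_left hCS (by positivity)
    _ = _ := by ring_nf

/-! ## §3 (6.4.7): the `κ_{N,r}` form -/

omit [Fintype d] [DecidableEq d] in
/-- Real-variable step of (6.4.7): `F₂² ≤ F₁F₃` gives `√F₂ √F₃ ≤ F₁^{1/4}F₃^{3/4} = F₁ κ³`,
`κ = (F₃/F₁)^{1/4}` (exponent written as `1/(2((r+2) − r))`). [folklore] -/
private theorem sqrt_mul_sqrt_le_mul_wavenumber_cube {F1 F2 F3 : ℝ} (hF1 : 0 < F1) (hF2 : 0 ≤ F2) (hF3 : 0 ≤ F3)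
    (h : F2 ^ 2 ≤ F1 * F3) (r : ℕ) :
    Real.sqrt F2 * Real.sqrt F3 ≤ F1 * ((F3 / F1) ^ (1 / (2 * (((r : ℝ) + 2) - r)))) ^ 3 := by
  have hexp : (1 : ℝ) / (2 * (((r : ℝ) + 2) - r)) = ((4 : ℕ) : ℝ)⁻¹ := by norm_num
  rw [hexp]
  have hP : 0 ≤ F3 / F1 := div_nonneg hF3 hF1.le
  set κ : ℝ := (F3 / F1) ^ ((4 : ℕ) : ℝ)⁻¹ with hκ
  have hκ0 : 0 ≤ κ := Real.rpow_nonneg hP _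
  have hκ4 : κ ^ 4 = F3 / F1 := Real.rpow_inv_natCast_pow hP (by norm_num)
  refine (pow_le_pow_iff_left₀ (by positivity) (by positivity) (by norm_num : (4 : ℕ) ≠ 0)).1 ?_
  have e1 : (Real.sqrt F2 * Real.sqrt F3) ^ 4 = F2 ^ 2 * F3 ^ 2 := by
    rw [mul_pow, show (4 : ℕ) = 2 * 2 by rfl, pow_mul, pow_mul, Real.sq_sqrt hF2, Real.sq_sqrt hF3]
  have e2 : (F1 * κ ^ 3) ^ 4 = F1 * F3 ^ 3 := by
    rw [mul_pow, ← pow_mul, show 3 * 4 = 4 * 3 by rfl, pow_mul, hκ4, div_pow]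
    field_simp
  rw [e1, e2]
  calc F2 ^ 2 * F3 ^ 2 ≤ F1 * F3 * F3 ^ 2 := mul_le_mul_of_nonneg_right h (sq_nonneg _)
    _ = F1 * F3 ^ 3 := by ring

/-- `κ_{r+2,r} ≤ κ_{N,r}` for `N ≥ r + 2` (the ordering, iterated). [cite: DoeringGibbon1995, §7.2.2] (bookkeeping) -/
private theorem wavenumber_add_two_le {g v : UnitAddTorus d → EuclideanSpace ℝ d} (hg : IsSmooth g)
    (hv : IsSmooth v) (ν : ℝ) {r : ℕ} (hFr : 0 < ladderF ν r g v) {N : ℕ} (hN : r + 2 ≤ N) :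
    (ladderF ν (r + 2) g v / ladderF ν r g v) ^ (1 / (2 * (((r : ℝ) + 2) - r))) ≤
      (ladderF ν N g v / ladderF ν r g v) ^ (1 / (2 * ((N : ℝ) - r))) := by
  induction N, hN using Nat.le_induction with
  | base => push_cast; exact le_rfl
  | succ N hN ih =>
    refine ih.trans ?_
    have h1 := ladderF_wavenumber_le_succ_left hg hv ν (r := r) (N := N) (by omega) hFr
    push_cast
    exact h1

/-- **Doering–Gibbon (6.4.7), `d = 3`, every rung**: for smooth zero-mean `v : T³ → ℝ³`, smooth `g`,
every `ν`, `r + 2 ≤ N`, `F_r > 0` (`F_n = ladderF ν n g v`) and every `x`,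

  `∑_{|α|=r} ‖∂^α v(x)‖² ≤ (2/π²) F_r κ³_{N,r}`,  `κ_{N,r} = (F_N/F_r)^{1/(2(N−r))}`,

i.e. `‖Dʳv‖_∞ ≤ c κ_{N,r}^{3/2} F_r^{1/2}` ("`κ_{N,r}` mediates between the `L^∞` and `L²` norms") — Agmon
at rung `r`, Lemma 6.3 (`F_{r+1}² ≤ F_rF_{r+2}`) and the ordering `κ_{r+2,r} ≤ κ_{N,r}`.
[cite: DoeringGibbon1995, §6.4 (6.4.6)–(6.4.7); §7.3.2 (7.3.22)] -/
theorem sum_norm_sq_wordDeriv_le_ladderF_mul_wavenumber_cube (hd : Fintype.card d = 3)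
    {g v : UnitAddTorus d → EuclideanSpace ℝ d} (hg : IsSmooth g) (hv : IsSmooth v) (hmean : HasZeroMean v)
    (ν : ℝ) {r N : ℕ} (hN : r + 2 ≤ N) (hFr : 0 < ladderF ν r g v) (x : UnitAddTorus d) :
    ∑ α : Fin r → d, ‖wordDeriv (List.ofFn α) v x‖ ^ 2 ≤
      2 / π ^ 2 * ladderF ν r g v * ((ladderF ν N g v / ladderF ν r g v) ^ (1 / (2 * ((N : ℝ) - r)))) ^ 3 := by
  have hπ : 0 < π := Real.pi_pos
  have hAg := sum_norm_sq_wordDeriv_le_agmon_wordEnergy hd hv hmean r x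
  -- `√E_{r+1}√E_{r+2} ≤ √F_{r+1}√F_{r+2} ≤ F_r κ³_{r+2,r} ≤ F_r κ³_{N,r}`
  have hmono : Real.sqrt (wordEnergy (r + 1) v) * Real.sqrt (wordEnergy (r + 2) v) ≤
      Real.sqrt (ladderF ν (r + 1) g v) * Real.sqrt (ladderF ν (r + 2) g v) :=
    mul_le_mul (Real.sqrt_le_sqrt (wordEnergy_le_ladderF ν (r + 1) g v))
      (Real.sqrt_le_sqrt (wordEnergy_le_ladderF ν (r + 2) g v)) (Real.sqrt_nonneg _) (Real.sqrt_nonneg _)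
  have hL : ladderF ν (r + 1) g v ^ 2 ≤ ladderF ν r g v * ladderF ν (r + 2) g v := by
    have h1 := ladderF_pow_le_pow_mul_pow hg hv ν (N := r + 1) (s := 1) (by omega) 1
    rw [show r + 1 - 1 = r by omega, show r + 1 + 1 = r + 2 by ring, show 1 + 1 = 2 by rfl, pow_one,
      pow_one] at h1
    exact h1
  have hC := sqrt_mul_sqrt_le_mul_wavenumber_cube hFr (ladderF_nonneg _ _ _ _) (ladderF_nonneg _ _ _ _) hL r
  have hord := wavenumber_add_two_le hg hv ν hFr hN
  have hκ0 : 0 ≤ (ladderF ν (r + 2) g v / ladderF ν r g v) ^ (1 / (2 * (((r : ℝ) + 2) - r))) :=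
    Real.rpow_nonneg (div_nonneg (ladderF_nonneg _ _ _ _) hFr.le) _
  have hpow := pow_le_pow_left₀ hκ0 hord 3
  calc ∑ α : Fin r → d, ‖wordDeriv (List.ofFn α) v x‖ ^ 2
      ≤ 2 / π ^ 2 * Real.sqrt (wordEnergy (r + 1) v) * Real.sqrt (wordEnergy (r + 2) v) := hAg
    _ ≤ 2 / π ^ 2 * (ladderF ν r g v * ((ladderF ν (r + 2) g v / ladderF ν r g v) ^ (1 / (2 * (((r : ℝ) + 2) - r)))) ^ 3) := by
        rw [mul_assoc]; exact mul_le_mul_of_nonneg_left (hmono.trans hC) (by positivity)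
    _ ≤ 2 / π ^ 2 * (ladderF ν r g v * ((ladderF ν N g v / ladderF ν r g v) ^ (1 / (2 * ((N : ℝ) - r)))) ^ 3) :=
        mul_le_mul_of_nonneg_left (mul_le_mul_of_nonneg_left hpow hFr.le) (by positivity)
    _ = _ := by ring

/-! ## §4 The same in the tree's `wordGradSq` notation (`|∇ʳv(x)|² = wordGradSq r v x`) -/

/-- **Agmon at every rung** in `wordGradSq` form: `|∇ʳv(x)|² ≤ (2/π²) E_{r+1}(v)^{1/2} E_{r+2}(v)^{1/2}` for
smooth zero-mean `v : T³ → ℝ³`. [cite: DoeringGibbon1995, §6.4 (6.4.6); Appendix A (A.0.18)] -/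
theorem wordGradSq_le_agmon_wordEnergy (hd : Fintype.card d = 3) {v : UnitAddTorus d → EuclideanSpace ℝ d}
    (hv : IsSmooth v) (hmean : HasZeroMean v) (r : ℕ) (x : UnitAddTorus d) :
    wordGradSq r v x ≤ 2 / π ^ 2 * Real.sqrt (wordEnergy (r + 1) v) * Real.sqrt (wordEnergy (r + 2) v) :=
  sum_norm_sq_wordDeriv_le_agmon_wordEnergy hd hv hmean r x

/-- **Agmon at rung `r + 1`, no mean condition**, `wordGradSq` form:
`|∇^{r+1}v(x)|² ≤ (2/π²) E_{r+2}(v)^{1/2} E_{r+3}(v)^{1/2}`. [cite: DoeringGibbon1995, §6.4 (6.4.6); Appendix A (A.0.18)] -/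
theorem wordGradSq_succ_le_agmon_wordEnergy (hd : Fintype.card d = 3) {v : UnitAddTorus d → EuclideanSpace ℝ d}
    (hv : IsSmooth v) (r : ℕ) (x : UnitAddTorus d) :
    wordGradSq (r + 1) v x ≤ 2 / π ^ 2 * Real.sqrt (wordEnergy (r + 2) v) * Real.sqrt (wordEnergy (r + 3) v) :=
  sum_norm_sq_wordDeriv_succ_le_agmon_wordEnergy hd hv r x

/-- **(6.4.7), `d = 3`**, `wordGradSq` form: `|∇ʳv(x)|² ≤ (2/π²) F_r κ³_{N,r}` for `N ≥ r + 2`, `F_r > 0`,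
smooth zero-mean `v`. [cite: DoeringGibbon1995, §6.4 (6.4.6)–(6.4.7)] -/
theorem wordGradSq_le_ladderF_mul_wavenumber_cube (hd : Fintype.card d = 3)
    {g v : UnitAddTorus d → EuclideanSpace ℝ d} (hg : IsSmooth g) (hv : IsSmooth v) (hmean : HasZeroMean v)
    (ν : ℝ) {r N : ℕ} (hN : r + 2 ≤ N) (hFr : 0 < ladderF ν r g v) (x : UnitAddTorus d) :
    wordGradSq r v x ≤
      2 / π ^ 2 * ladderF ν r g v * ((ladderF ν N g v / ladderF ν r g v) ^ (1 / (2 * ((N : ℝ) - r)))) ^ 3 :=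
  sum_norm_sq_wordDeriv_le_ladderF_mul_wavenumber_cube hd hg hv hmean ν hN hFr x

end Torus

end Literature.Analysis.FluidPDE

end
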